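import Literature.MathematicalPhysics.KineticTheory.HardSphereCanonicalKS
import Literature.MathematicalPhysics.KineticTheory.HardSphereCanonicalPairBound
import Literature.MathematicalPhysics.StatisticalMechanics.HardSphereKirkwoodSalsburg
import HarnessLib

/-!
# The thermodynamic limit of the canonical hard-sphere correlation functions at contact scale

Topic `Literature/MathematicalPhysics/KineticTheory`.  For `N + 1` hard spheres of diameter
`ε_N = σ (N+1)^{-1/3}` on `𝕋³` (uniform activity, fixed small reduced density `σ`) the NORMALISED
pinned probabilities

  `v_n(y) = u_ε(y)(n − k) / Ξ_ε(n)`      (`vcan`; `y` a `k`-point configuration, `n` particles)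

— `ρ_k^{(n)}/n^k` up to `1 + O(k²/n)` — converge, as `N → ∞` at the microscopic (contact) scale
`y = y₀ + ε ·(lifted configuration)`, to the infinite-volume correlation functions
`g_k = ksCorr (σ³) (R σ)` of `StatisticalMechanics/HardSphereKirkwoodSalsburg` (Ruelle's
Kirkwood–Salsburg fixed point in the density normalisation, `R = ratioLimit uniformProfile σ`
the limit insertion ratio of `HardSphereEulerRatio`), uniformly over all configurations of bounded
microscopic diameter and all `k` in Ruelle's weighted sup-norm:

  `sup_{k, diam(y) ≤ Lε} 4^{-k} |v_{N+1}(y) − g_k(ε⁻¹ ỹ)| → 0`      (`tendsto_vcan_sub_ksCorr`).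

Method (Bogoliubov–Khatset–Petrina; Ruelle §4.2 in the canonical ensemble): the exact canonical
Kirkwood–Salsburg identity of `HardSphereCanonicalKS` (`pinnedXi_cons_eq_sum`), divided by
`Ξ_ε(n)`, is the infinite-volume equation `g = T_{ρ,R} g` up to (i) the ratio `Ξ(n−1)/Ξ(n) → R`
(`tendsto_qN_sub`), (ii) the prefactors `C(n−k, j) ε^{3j} → ρ^j/j!` and (iii) the chart
`𝕋³ ⊃ B(y₀, Lε) ≅ B(0, L) ⊂ ℝ³` (an isometry for `Lε < 1/4`, carrying Haar to `ε³ ×` Lebesgue);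
the contraction of `T` then improves an error bound `b` on the level `n − 1` to `θ b + o(1)` on
level `n`, and `s` steps from the trivial bound give `2θ^s + o(1)/(1−θ)`.

## References

* D. Ruelle, *Statistical Mechanics: Rigorous Results* (1969), §4.2, Thm 4.2.3.  [Ruelle1969]
* E. Pulvirenti, D. Tsagkarogiannis, Comm. Math. Phys. 316 (2012) 289–306, Thm 2.1, §5
  (thermodynamic limit of the canonical ensemble with periodic boundary conditions).
  [PulvirentiTsagkarogiannis2012]
-/

noncomputable section

open MeasureTheory Set Filter Function Metric
open scoped ENNReal BigOperators Topology Classical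

namespace Literature.MathematicalPhysics.KineticTheory

open StatisticalMechanics Literature.Analysis.FluidPDE Literature.Analysis.FunctionSpaces

/-! ### The canonical partition functions as pinned probabilities -/

/-- The canonical hard-core probability of the first `m` of `n` labels is the pinned probability
with nothing pinned: `Ξ(firstLabels n m) = u_ε(∅)(m)`. [folklore] -/
theorem hcProb_firstLabels_eq_pinnedXi (ε : ℝ) {m n : ℕ} (h : m ≤ n) :
    hcProb (Ov ε) (volume : Measure T3) (firstLabels n m) =
      pinnedXi ε (fun i : Fin 0 => Fin.elim0 i) m := by
  rw [pinnedXi_elim0_eq_hcProb, ← integral_efR volume (measurableSet_ov ε),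
    ← integral_efR volume (measurableSet_ov ε)]
  have hF : Measurable fun y : Fin m → T3 => efR (Ov ε) y Finset.univ :=
    measurable_efR (measurableSet_ov ε) _
  have key := integral_pi_comp_castLE uniformProfile h hF
  rw [uniformProfile_μ] at key
  rw [← volume_pi, ← volume_pi] at key
  rw [← volume_pi, ← volume_pi, ← key]
  refine integral_congr_ae (ae_of_all _ fun x => ?_)
  show efR (Ov ε) x (firstLabels n m) = efR (Ov ε) (fun i => x (Fin.castLE h i)) Finset.univ
  rw [efR_eq_indicator, efR_eq_indicator]
  have hmem : x ∈ hardCoreSet (Ov ε) (firstLabels n m) ↔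
      (fun i : Fin m => x (Fin.castLE h i)) ∈ hardCoreSet (Ov ε) (Finset.univ : Finset (Fin m)) := by
    simp only [hardCoreSet, mem_setOf_eq, Finset.mem_univ, forall_const, mem_firstLabels]
    constructor
    · intro H a b hab
      exact H (Fin.castLE h a) a.isLt (Fin.castLE h b) b.isLt fun e => hab (Fin.castLE_injective h e)
    · intro H i hi j hj hij
      have := H ⟨i, hi⟩ ⟨j, hj⟩ (fun e => hij (by
        have := congrArg Fin.val e; exact Fin.ext this))
      simpa using this
  by_cases hx : x ∈ hardCoreSet (Ov ε) (firstLabels n m)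
  · rw [indicator_of_mem hx, indicator_of_mem (hmem.1 hx)]; rfl
  · rw [indicator_of_notMem hx, indicator_of_notMem (fun h' => hx (hmem.2 h'))]

/-- `Ξ_ε(n) = u_ε(∅)(n)`: the canonical hard-core probability of `n` points of `𝕋³` at scale `ε`.
[cite: PulvirentiTsagkarogiannis2012, §3] -/
def XiT (ε : ℝ) (n : ℕ) : ℝ := pinnedXi ε (fun i : Fin 0 => Fin.elim0 i) n

/-- **Bridge to the canonical theory of the tree**: `Ξ_N(m) = Ξ_{ε_N}(m)` for the uniform profile,
`m ≤ N + 1`. [folklore] -/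
theorem XiN_uniform_eq_XiT (σ : ℝ) {N m : ℕ} (hm : m ≤ N + 1) :
    XiN uniformProfile σ N m = XiT (hsDiameter σ N) m := by
  rw [XiN, Xi, uniformProfile_μ, hcProb_firstLabels_eq_pinnedXi _ hm, XiT]

/-- `0 ≤ Ξ_ε(n) ≤ 1`. [folklore] -/
theorem XiT_nonneg (ε : ℝ) (n : ℕ) : 0 ≤ XiT ε n := pinnedXi_nonneg ε _ n

/-- **The normalised pinned probability** `v_n(y) = u_ε(y)(n − k)/Ξ_ε(n)` of a `k`-point
configuration in the `n`-particle canonical gas (`= ρ_k^{(n)}(y) (n−k)!/ n!`, the `k`-point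
correlation function in the density normalisation up to `1 + O(k²/n)`).
[cite: PulvirentiTsagkarogiannis2012, §5] -/
def vcan (ε : ℝ) (n : ℕ) {k : ℕ} (y : Fin k → T3) : ℝ := pinnedXi ε y (n - k) / XiT ε n

/-- `0 ≤ v_n(y)`. [folklore] -/
theorem vcan_nonneg (ε : ℝ) (n : ℕ) {k : ℕ} (y : Fin k → T3) : 0 ≤ vcan ε n y :=
  div_nonneg (pinnedXi_nonneg ε y _) (XiT_nonneg ε n)

/-- `v_n(∅) = 1`. [folklore] -/
theorem vcan_elim0 (ε : ℝ) {n : ℕ} (hΞ : 0 < XiT ε n) (y : Fin 0 → T3) : vcan ε n y = 1 := by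
  rw [vcan, Nat.sub_zero, show y = fun i => Fin.elim0 i from funext fun i => Fin.elim0 i]
  exact div_self hΞ.ne'

/-! ### A priori bounds along the hydrodynamic scaling -/

section Scaling

variable {σ : ℝ} (h : SmallDensity uniformProfile σ)
include h

/-- `Ξ_{ε_N}(m) ≤ 2 Ξ_{ε_N}(m+1)` for `m ≤ N` (insertion bound, `λ ≤ 1/2`). [folklore] -/
theorem XiT_le_two_mul_succ {N m : ℕ} (hm : m ≤ N) :
    XiT (hsDiameter σ N) m ≤ 2 * XiT (hsDiameter σ N) (m + 1) := by
  have h1 := XiN_mul_le_succ (P := uniformProfile) h.σ_pos.le h.σ_lt_half (N := N) hm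
  rw [XiN_uniform_eq_XiT σ (by omega), XiN_uniform_eq_XiT σ (by omega)] at h1
  have hl := h.ovDensity_le_half
  nlinarith [XiT_nonneg (hsDiameter σ N) m]

/-- `0 < Ξ_{ε_N}(m)` for `m ≤ N + 1`. [folklore] -/
theorem XiT_pos {N m : ℕ} (hm : m ≤ N + 1) : 0 < XiT (hsDiameter σ N) m := by
  rw [← XiN_uniform_eq_XiT σ hm]
  exact XiN_pos h.σ_pos.le h.σ_lt_half h.ovDensity_lt_one hm

/-- `Ξ_{ε_N}(n − k) ≤ 2^k Ξ_{ε_N}(n)` for `k ≤ n ≤ N + 1`. [folklore] -/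
theorem XiT_sub_le_pow_mul {N n k : ℕ} (hn : n ≤ N + 1) (hk : k ≤ n) :
    XiT (hsDiameter σ N) (n - k) ≤ 2 ^ k * XiT (hsDiameter σ N) n := by
  induction k with
  | zero => simp
  | succ k ih =>
    have h1 := XiT_le_two_mul_succ h (N := N) (m := n - (k + 1)) (by omega)
    rw [show n - (k + 1) + 1 = n - k by omega] at h1
    calc XiT (hsDiameter σ N) (n - (k + 1)) ≤ 2 * XiT (hsDiameter σ N) (n - k) := h1
      _ ≤ 2 * (2 ^ k * XiT (hsDiameter σ N) n) := by
          exact mul_le_mul_of_nonneg_left (ih (by omega)) (by norm_num)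
      _ = 2 ^ (k + 1) * XiT (hsDiameter σ N) n := by ring

/-- **A priori bound** `v_n(y) ≤ 2^k` for `k ≤ n ≤ N + 1` (Ruelle (2.15) in the canonical ensemble:
`u(y)(n−k) ≤ Ξ(n−k) ≤ 2^k Ξ(n)`). [cite: Ruelle1969, §4.2.2 (2.15)] -/
theorem vcan_le_two_pow {N n k : ℕ} (hn : n ≤ N + 1) (hk : k ≤ n) (y : Fin k → T3) :
    vcan (hsDiameter σ N) n y ≤ 2 ^ k := by
  rw [vcan, div_le_iff₀ (XiT_pos h hn)]
  exact (pinnedXi_le_pinnedXi_elim0 _ y _).trans (XiT_sub_le_pow_mul h hn hk)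

omit h in
/-- The insertion ratio `Ξ(n−1)/Ξ(n)` of the tree in the `XiT` vocabulary: `q_N(n−1)`. [folklore] -/
theorem qN_eq_XiT_div {N n : ℕ} (hn1 : 1 ≤ n) (hn : n ≤ N + 1) :
    qN uniformProfile σ N (n - 1) = XiT (hsDiameter σ N) (n - 1) / XiT (hsDiameter σ N) n := by
  rw [qN, XiN_uniform_eq_XiT σ (by omega), XiN_uniform_eq_XiT σ (by omega),
    show n - 1 + 1 = n by omega]

end Scaling

/-! ### The Kirkwood–Salsburg identity for the normalised functions -/

/-- **The canonical Kirkwood–Salsburg identity, normalised form**: for `k + 1 ≤ n`,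
`v_n(y₁ :: y') = (Ξ(n−1)/Ξ(n)) 𝟙[wall] ∑_{j ≤ n−1−k} (−1)^j C(n−1−k, j) ∫ 𝟙[z ⊂ B(y₁,ε)] v_{n−1}(y' ++ z) dz`.
[cite: Ruelle1969, §4.2.1 (2.13)] -/
theorem vcan_cons (ε : ℝ) {n k : ℕ} (hΞ : 0 < XiT ε (n - 1)) (hΞn : 0 < XiT ε n) (y₁ : T3)
    (y' : Fin k → T3) :
    vcan ε n (Fin.cons y₁ y') = XiT ε (n - 1) / XiT ε n * (wallInd ε y₁ y' *
      ∑ j ∈ Finset.range (n - (k + 1) + 1), (-1 : ℝ) ^ j * ((n - (k + 1)).choose j : ℝ) *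
        ∫ z : Fin j → T3, ballInd ε y₁ z * vcan ε (n - 1) (Fin.append y' z)) := by
  unfold vcan
  have hsub : ∀ j, n - 1 - (k + j) = n - (k + 1) - j := fun j => by omega
  simp_rw [hsub]
  have hI : ∀ j, ∫ z : Fin j → T3, ballInd ε y₁ z *
      (pinnedXi ε (Fin.append y' z) (n - (k + 1) - j) / XiT ε (n - 1)) =
        ksJ ε y₁ y' j (n - (k + 1) - j) / XiT ε (n - 1) := by
    intro j
    rw [ksJ, ← integral_div]
    refine integral_congr_ae (ae_of_all _ fun z => ?_)
    ring
  simp_rw [hI]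
  rw [pinnedXi_cons_eq_sum, Finset.mul_sum, Finset.mul_sum, Finset.sum_div, Finset.mul_sum]
  refine Finset.sum_congr rfl fun j _ => ?_
  field_simp

/-! ### The chart: Haar integrals of ball-supported integrands are `ε³ ×` Lebesgue integrals -/

/-- The ball points in the chart: `τ(ζ)_i = y₁ + proj(ε ζ_i)`. [folklore] -/
def chartPts (ε : ℝ) (y₁ : T3) {j : ℕ} (ζ : Fin j → E3) : Fin j → T3 :=
  fun i => y₁ + Torus.proj (ε • ζ i)

/-- `ζ ↦ τ(ζ)` is measurable. [folklore] -/
theorem measurable_chartPts (ε : ℝ) (y₁ : T3) (j : ℕ) :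
    Measurable fun ζ : Fin j → E3 => chartPts ε y₁ ζ :=
  measurable_pi_lambda _ fun i => measurable_const.add
    (Torus.measurable_proj.comp ((measurable_pi_apply i).const_smul ε))

/-- **The chart identity**: for `0 < ε < 1/2` and measurable `H`,
`∫_{(𝕋³)^j} 𝟙[z ⊂ B(y₁,ε)] H(z) dz = ε^{3j} ∫_{(ℝ³)^j} 𝟙[ζ ⊂ B(0,1)] H(τ(ζ)) dζ`
(translation invariance of Haar measure, the product chart `map_proj_pi_restrict_cubes`, and the
scaling `u = ε ζ`). [folklore] -/
theorem integral_ballInd_mul_eq_pow_mul {ε : ℝ} (hε : 0 < ε) (hε2 : ε < 1 / 2) (y₁ : T3) {j : ℕ}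
    {H : (Fin j → T3) → ℝ} (hH : Measurable H) :
    ∫ z : Fin j → T3, ballInd ε y₁ z * H z =
      ε ^ (3 * j) * ∫ ζ : Fin j → E3, HardSphereKS.ballProd (0 : E3) ζ * H (chartPts ε y₁ ζ) := by
  -- Step 0: translation `z = y₁ + t`
  set e : (Fin j → T3) ≃ᵐ (Fin j → T3) :=
    MeasurableEquiv.piCongrRight fun _ : Fin j => MeasurableEquiv.addLeft y₁ with he
  have hmp : MeasurePreserving e (volume : Measure (Fin j → T3)) volume :=
    measurePreserving_pi (fun _ : Fin j => (volume : Measure T3)) (fun _ => volume)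
      fun _ => measurePreserving_add_left volume y₁
  have h0 : ∫ z : Fin j → T3, ballInd ε y₁ z * H z =
      ∫ t : Fin j → T3, ballInd ε y₁ (fun i => y₁ + t i) * H (fun i => y₁ + t i) :=
    (hmp.integral_comp' (fun z => ballInd ε y₁ z * H z)).symm
  -- Step 1: the ball indicator at translated points
  have h1 : ∀ t : Fin j → T3, ballInd ε y₁ (fun i => y₁ + t i) =
      if ∀ i, ‖Torus.reprSym (t i)‖ < ε then 1 else 0 := by
    intro t
    simp only [ballInd, Ov, Torus.euclidDist_eq, add_sub_cancel_left]
  set Φ : (Fin j → T3) → ℝ := fun t => ballInd ε y₁ (fun i => y₁ + t i) * H (fun i => y₁ + t i)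
    with hΦ
  have htr : Measurable fun (t : Fin j → T3) (i : Fin j) => y₁ + t i :=
    measurable_pi_lambda _ fun i => measurable_const.add (measurable_pi_apply i)
  have hΦm : Measurable Φ := (measurable_ballInd_comp ε y₁ htr).mul (hH.comp htr)
  have hL : Measurable fun (u : Fin j → E3) (i : Fin j) => Torus.proj (u i) :=
    measurable_pi_lambda _ fun i => Torus.measurable_proj.comp (measurable_pi_apply i)
  -- Step 2: pull back along the product chart
  have step1 : ∫ t, Φ t = ∫ u in cubes j, Φ (fun i => Torus.proj (u i)) := by
    rw [← map_proj_pi_restrict_cubes j, integral_map hL.aemeasurable hΦm.aestronglyMeasurable]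
  set Ψ : (Fin j → E3) → ℝ := fun u =>
    (if ∀ i, ‖u i‖ < ε then 1 else 0) * H (fun i => y₁ + Torus.proj (u i)) with hΨ
  have step2 : ∫ u in cubes j, Φ (fun i => Torus.proj (u i)) = ∫ u in cubes j, Ψ u := by
    refine setIntegral_congr_fun (measurableSet_cubes j) fun u hu => ?_
    have hr : ∀ i, Torus.reprSym (Torus.proj (u i)) = u i := fun i =>
      reprSym_proj_of_mem_symCube' (hu i (mem_univ i))
    simp only [hΦ, hΨ, h1, hr]
  -- Step 3: the integrand vanishes off the cubes
  have step3 : ∫ u in cubes j, Ψ u = ∫ u, Ψ u := by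
    refine setIntegral_eq_integral_of_forall_compl_eq_zero fun u hu => ?_
    simp only [hΨ]
    rw [if_neg, zero_mul]
    intro hball
    exact hu fun i _ => mem_symCube_of_norm_lt ((hball i).trans hε2)
  -- Step 4: scaling `u = ε ζ`
  have step4 : ∫ u, Ψ u = ε ^ (3 * j) * ∫ ζ : Fin j → E3, Ψ (ε • ζ) := by
    have hs := Measure.integral_comp_smul (volume : Measure (Fin j → E3)) Ψ ε
    have hdim : Module.finrank ℝ (Fin j → E3) = 3 * j := by
      rw [Module.finrank_pi_fintype]; simp [mul_comm]
    rw [hdim, abs_inv, abs_of_pos (pow_pos hε _), smul_eq_mul] at hs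
    rw [hs, ← mul_assoc, mul_inv_cancel₀ (pow_ne_zero _ hε.ne'), one_mul]
  have step5 : ∀ ζ : Fin j → E3, Ψ (ε • ζ) =
      HardSphereKS.ballProd (0 : E3) ζ * H (chartPts ε y₁ ζ) := by
    intro ζ
    have hcond : (∀ i, ‖ε • ζ i‖ < ε) ↔ ∀ i, dist (ζ i) 0 < 1 := by
      refine forall_congr' fun i => ?_
      rw [norm_smul, Real.norm_eq_abs, abs_of_pos hε, dist_zero_right, mul_lt_iff_lt_one_right hε]
    simp only [hΨ, HardSphereKS.ballProd, Pi.smul_apply, hcond]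
    rfl
  rw [h0]
  change ∫ t, Φ t = _
  rw [step1, step2, step3, step4]
  congr 1
  exact integral_congr_ae (ae_of_all _ step5)

/-! ### The lift of a clustered configuration to `ℝ³` -/

/-- The lift of a configuration about the base point `b` at scale `ε`:
`(lift y)_a = ε⁻¹ · reprSym (y_a − b)`. [folklore] -/
def liftAt (ε : ℝ) (b : T3) {k : ℕ} (y : Fin k → T3) : Fin k → E3 :=
  fun a => ε⁻¹ • Torus.reprSym (y a - b)

/-- **Additivity of the minimal image on small triangles**: if `x` and `x'` are within minimal-image
distance `1/4` of `b`, then `reprSym (x − x') = reprSym (x − b) − reprSym (x' − b)`. [folklore] -/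
theorem reprSym_sub_eq_sub {x x' b : T3} (hx : Torus.euclidDist x b < 1 / 4)
    (hx' : Torus.euclidDist x' b < 1 / 4) :
    Torus.reprSym (x - x') = Torus.reprSym (x - b) - Torus.reprSym (x' - b) := by
  rw [Torus.euclidDist_eq] at hx hx'
  have hdecomp : x - x' = (x - b) + Torus.proj (-Torus.reprSym (x' - b)) := by
    rw [Torus.proj_neg, Torus.proj_reprSym]; abel
  rw [hdecomp, Torus.reprSym_add_proj_of_norm_lt (by rw [norm_neg]; linarith)]
  abel

/-- **The lift is an isometry up to the factor `ε⁻¹`** on configurations within `1/4` of the base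
point. [folklore] -/
theorem dist_liftAt {ε : ℝ} (hε : 0 < ε) {b : T3} {k : ℕ} {y : Fin k → T3}
    (hy : ∀ a, Torus.euclidDist (y a) b < 1 / 4) (a a' : Fin k) :
    dist (liftAt ε b y a) (liftAt ε b y a') = ε⁻¹ * Torus.euclidDist (y a) (y a') := by
  simp only [liftAt, dist_eq_norm, ← smul_sub]
  rw [← reprSym_sub_eq_sub (hy a) (hy a'), norm_smul, Real.norm_eq_abs, abs_of_pos (inv_pos.2 hε),
    Torus.euclidDist_eq]

/-- **Change of base point is a translation of the lift.** [folklore] -/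
theorem liftAt_eq_add_liftAt {ε : ℝ} {b b' : T3} {k : ℕ} {y : Fin k → T3}
    (hy : ∀ a, Torus.euclidDist (y a) b < 1 / 4) (hb' : Torus.euclidDist b' b < 1 / 4) (a : Fin k) :
    liftAt ε b' y a = -(ε⁻¹ • Torus.reprSym (b' - b)) + liftAt ε b y a := by
  simp only [liftAt]
  rw [reprSym_sub_eq_sub (hy a) hb', smul_sub]
  abel

/-- The lift of the chart points about their centre is the identity on the unit ball. [folklore] -/
theorem liftAt_chartPts {ε : ℝ} (hε : 0 < ε) (hε2 : ε < 1 / 2) (y₁ : T3) {j : ℕ} {ζ : Fin j → E3}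
    (hζ : ∀ i, dist (ζ i) 0 < 1) : liftAt ε y₁ (chartPts ε y₁ ζ) = ζ := by
  funext i
  simp only [liftAt, chartPts, add_sub_cancel_left]
  have hn : ‖ε • ζ i‖ < 1 / 2 := by
    rw [norm_smul, Real.norm_eq_abs, abs_of_pos hε]
    have := hζ i
    rw [dist_zero_right] at this
    nlinarith
  rw [reprSym_proj_of_norm_lt hn, smul_smul, inv_mul_cancel₀ hε.ne', one_smul]

/-- The chart points lie within `ε` of their centre (on the unit ball). [folklore] -/
theorem euclidDist_chartPts_lt {ε : ℝ} (hε : 0 < ε) (hε2 : ε < 1 / 2) (y₁ : T3) {j : ℕ}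
    {ζ : Fin j → E3} (hζ : ∀ i, dist (ζ i) 0 < 1) (i : Fin j) :
    Torus.euclidDist (chartPts ε y₁ ζ i) y₁ < ε := by
  simp only [chartPts, Torus.euclidDist_eq, add_sub_cancel_left]
  have hn : ‖ε • ζ i‖ < ε := by
    rw [norm_smul, Real.norm_eq_abs, abs_of_pos hε]
    have := hζ i
    rw [dist_zero_right] at this
    exact (mul_lt_iff_lt_one_right hε).2 this
  rwa [reprSym_proj_of_norm_lt (hn.trans hε2)]

/-- The lift commutes with `Fin.append`. [folklore] -/
theorem liftAt_append (ε : ℝ) (b : T3) {k j : ℕ} (y : Fin k → T3) (w : Fin j → T3) :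
    liftAt ε b (Fin.append y w) = Fin.append (liftAt ε b y) (liftAt ε b w) := by
  funext a
  refine Fin.addCases (fun i => ?_) (fun i => ?_) a
  · simp only [liftAt, Fin.append_left]
  · simp only [liftAt, Fin.append_right]

/-- The lift commutes with `Fin.cons`, and the base point lifts to `0`. [folklore] -/
theorem liftAt_cons (ε : ℝ) (y₁ : T3) {k : ℕ} (y' : Fin k → T3) :
    liftAt ε y₁ (Fin.cons y₁ y') = Fin.cons (0 : E3) (liftAt ε y₁ y') := by
  funext a
  refine Fin.cases ?_ (fun i => ?_) a
  · simp [liftAt]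
  · simp only [liftAt, Fin.cons_succ]

/-- **The wall factors agree**: `𝟙[y₁ ∼ y'] = wall(lift (y₁ :: y'))`. [folklore] -/
theorem wallInd_eq_wall {ε : ℝ} (hε : 0 < ε) (y₁ : T3) {k : ℕ} (y' : Fin k → T3) :
    wallInd ε y₁ y' = HardSphereKS.wall (liftAt ε y₁ (Fin.cons y₁ y')) := by
  rw [liftAt_cons]
  have hcond : (∀ a, ¬ Ov ε y₁ (y' a)) ↔
      ∀ i : Fin k, 1 ≤ dist ((Fin.cons (0 : E3) (liftAt ε y₁ y') : Fin (k + 1) → E3) i.succ)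
        ((Fin.cons (0 : E3) (liftAt ε y₁ y') : Fin (k + 1) → E3) 0) := by
    refine forall_congr' fun a => ?_
    rw [Fin.cons_succ, Fin.cons_zero, not_ov_comm, Ov, not_lt, dist_zero_right]
    simp only [liftAt, norm_smul, Real.norm_eq_abs, abs_of_pos (inv_pos.2 hε), ← Torus.euclidDist_eq]
    rw [← div_eq_inv_mul, le_div_iff₀ hε, one_mul]
  simp only [wallInd, HardSphereKS.wall, hcond]

/-! ### Constants and smallness -/

/-- The limit correlation functions `g = ksCorr (σ³) (R σ)` on `ℝ³` (density normalisation).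
[cite: Ruelle1969, §4.2.3 Thm 4.2.3] -/
def gLim (σ : ℝ) : HardSphereKS.CorrSeq E3 := HardSphereKS.ksCorr (σ ^ 3) (ratioLimit uniformProfile σ)

/-- The contraction ratio `θ₀ = exp(4 v₁ σ³)/2` of the one-step estimate. [folklore] -/
def thetaZero (σ : ℝ) : ℝ := Real.exp (4 * (v₁ * σ ^ 3)) / 2

/-- `v₁` of the tree is `v1 E3` of `HardSphereKS`. [folklore] -/
theorem v1_E3_eq : HardSphereKS.v1 E3 = v₁ := rfl

/-- `exp(1/4) < 2`. [folklore] -/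
theorem exp_quarter_lt_two : Real.exp (1 / 4) < 2 := by
  have h := Real.abs_exp_sub_one_sub_id_le (x := 1 / 4) (by rw [abs_le]; constructor <;> norm_num)
  rw [abs_le] at h
  linarith [h.2]

/-- `exp(3/16) < 3/2`. [folklore] -/
theorem exp_three_sixteenth_lt : Real.exp (3 / 16) < 3 / 2 := by
  have h := Real.abs_exp_sub_one_sub_id_le (x := 3 / 16) (by rw [abs_le]; constructor <;> norm_num)
  rw [abs_le] at h
  linarith [h.2]

section Small

variable {σ : ℝ} (h : SmallDensity uniformProfile σ)
include h

/-- Under `SmallDensity`, `λ = v₁ σ³ < 1/16` (from `eθ/(1−θ) < 1/2`, `θ = 2eλ`, `e ≥ 2`). [folklore] -/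
theorem ovDensity_lt_sixteenth : v₁ * σ ^ 3 < 1 / 16 := by
  have he : (2 : ℝ) ≤ Real.exp 1 := by have := Real.add_one_le_exp (1 : ℝ); linarith
  have hφ := h.phi_lt_half
  have hg1 := h.geomRatio_lt_one
  have hg0 := h.geomRatio_nonneg
  have hθ : geomRatio uniformProfile σ = 2 * Real.exp 1 * (v₁ * σ ^ 3) := by
    rw [geomRatio, ovDensity_uniformProfile]
  rw [div_lt_iff₀ (by linarith)] at hφ
  rw [hθ] at hφ hg0 hg1
  have hl0 : 0 ≤ v₁ * σ ^ 3 := by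
    have := h.ovDensity_nonneg; rwa [ovDensity_uniformProfile] at this
  nlinarith [mul_nonneg hl0 (by positivity : (0 : ℝ) ≤ Real.exp 1 * Real.exp 1),
    mul_le_mul he he (by norm_num) (by positivity)]

/-- `0 ≤ θ₀ < 1`. [folklore] -/
theorem thetaZero_lt_one : thetaZero σ < 1 := by
  have h1 : Real.exp (4 * (v₁ * σ ^ 3)) < 2 :=
    (Real.exp_lt_exp.2 (by linarith [ovDensity_lt_sixteenth h])).trans exp_quarter_lt_two
  unfold thetaZero; linarith

omit h in
/-- `0 ≤ θ₀`. [folklore] -/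
theorem thetaZero_nonneg : 0 ≤ thetaZero σ := by unfold thetaZero; positivity

/-- **The Kirkwood–Salsburg contraction ratio at `ξ = 3` is `< 1`** under `SmallDensity`
(`|R| ≤ 2`, `(2/3) e^{3λ} < 1`). [folklore] -/
theorem ksRatio_three_lt_one : HardSphereKS.ksRatio E3 (σ ^ 3) (ratioLimit uniformProfile σ) 3 < 1 := by
  unfold HardSphereKS.ksRatio
  rw [v1_E3_eq, abs_of_pos (pow_pos h.σ_pos 3), abs_of_pos h.ratioLimit_pos]
  have hR := h.ratioLimit_mem.2
  have h1 : Real.exp (σ ^ 3 * v₁ * 3) < 3 / 2 :=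
    (Real.exp_lt_exp.2 (by nlinarith [ovDensity_lt_sixteenth h])).trans exp_three_sixteenth_lt
  have h0 : 0 < Real.exp (σ ^ 3 * v₁ * 3) := Real.exp_pos _
  nlinarith

/-- The fixed-point equation of the limit correlation functions. [cite: Ruelle1969, §4.2.3 Thm 4.2.3] -/
theorem ksOp_gLim : HardSphereKS.ksOp (σ ^ 3) (ratioLimit uniformProfile σ) (gLim σ) = gLim σ :=
  HardSphereKS.ksOp_ksCorr (by norm_num) (ksRatio_three_lt_one h)

/-- `|g_k| ≤ 3^k`. [cite: Ruelle1969, §4.2.2 (2.15)] -/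
theorem abs_gLim_le (k : ℕ) (x : Fin k → E3) : |gLim σ k x| ≤ 3 ^ k :=
  HardSphereKS.abs_ksCorr_le (by norm_num) (ksRatio_three_lt_one h) k x

/-- `g_k` is measurable. [folklore] -/
theorem measurable_gLim (k : ℕ) : Measurable (gLim σ k) :=
  HardSphereKS.measurable_ksCorr (by norm_num) (ksRatio_three_lt_one h) k

/-- `g` is translation invariant. [cite: Ruelle1969, §4.2.3 Thm 4.2.3] -/
theorem gLim_const_add (a : E3) (k : ℕ) (x : Fin k → E3) : gLim σ k (fun i => a + x i) = gLim σ k x :=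
  HardSphereKS.ksCorr_const_add (by norm_num) (ksRatio_three_lt_one h) a k x

/-- `g_0 = 1`. [folklore] -/
theorem gLim_zero (x : Fin 0 → E3) : gLim σ 0 x = 1 := by
  rw [← ksOp_gLim h]; rfl

/-- The Kirkwood–Salsburg series of `g` is summable. [folklore] -/
theorem summable_ksTerm_gLim (m : ℕ) (x : Fin (m + 1) → E3) :
    Summable fun n => HardSphereKS.ksTerm (σ ^ 3) (gLim σ) m n x :=
  HardSphereKS.summable_ksTerm (σ ^ 3) (ξ := 3) (C := 1)
    (fun k y => by rw [one_mul]; exact abs_gLim_le h k y) m x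

end Small

/-! ### Integrals against the product-ball indicator -/

/-- The ball-supported integral bound with the pointwise bound only required ON the ball.
[cite: Ruelle1969, §4.2.2 (2.19)] -/
theorem abs_integral_ballProd_mul_le_of_ball {n : ℕ} {F : (Fin n → E3) → ℝ} {M : ℝ} (hM : 0 ≤ M)
    (hF : ∀ y : Fin n → E3, (∀ j, dist (y j) 0 < 1) → |F y| ≤ M) :
    |∫ y, HardSphereKS.ballProd (0 : E3) y * F y| ≤ v₁ ^ n * M := by
  have heq : ∀ y : Fin n → E3, HardSphereKS.ballProd (0 : E3) y * F y =
      HardSphereKS.ballProd (0 : E3) y * (if ∀ j, dist (y j) 0 < 1 then F y else 0) := by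
    intro y
    unfold HardSphereKS.ballProd
    split_ifs <;> simp
  simp_rw [heq]
  rw [← v1_E3_eq]
  refine HardSphereKS.abs_integral_ballProd_mul_le (0 : E3) fun y => ?_
  split_ifs with hy
  · exact hF y hy
  · rw [abs_zero]; exact hM

/-- Integrability of `𝟙[y ⊂ B(0,1)] F(y)` for bounded measurable `F`. [folklore] -/
theorem integrable_ballProd_mul {n : ℕ} {F : (Fin n → E3) → ℝ} (hFm : Measurable F) {M : ℝ}
    (hF : ∀ y, |F y| ≤ M) : Integrable fun y => HardSphereKS.ballProd (0 : E3) y * F y := by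
  have hS := HardSphereKS.measurableSet_ballPi (0 : E3) n
  have heq : (fun y => HardSphereKS.ballProd (0 : E3) y * F y) =
      (Set.pi univ fun _ : Fin n => ball (0 : E3) 1).indicator F := by
    funext y
    rw [HardSphereKS.ballProd_apply_eq_indicator]
    by_cases hy : y ∈ Set.pi univ fun _ : Fin n => ball (0 : E3) 1
    · rw [indicator_of_mem hy, indicator_of_mem hy, Pi.one_apply, one_mul]
    · rw [indicator_of_notMem hy, indicator_of_notMem hy, zero_mul]
  rw [heq, integrable_indicator_iff hS]
  exact Measure.integrableOn_of_bounded (HardSphereKS.volume_ballPi_lt_top (0 : E3) n).ne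
    hFm.aestronglyMeasurable (M := M) (Eventually.of_forall fun y => by
      rw [Real.norm_eq_abs]; exact hF _)

/-! ### The invariant and the one-step estimate -/

/-- **The comparison invariant** at level `n`, window `r`, bound `b`: every configuration
within minimal-image distance `r` of a centre `c`, lifted about `c`, has `|v_n − g_k ∘ lift| ≤ b 4^k`.
[folklore] -/
def KSInv (σ : ℝ) (N n : ℕ) (r b : ℝ) : Prop :=
  ∀ (k : ℕ) (Y : Fin k → T3) (c : T3), (∀ a, Torus.euclidDist (Y a) c < r) →
    |vcan (hsDiameter σ N) n Y - gLim σ k (liftAt (hsDiameter σ N) c Y)| ≤ b * 4 ^ k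

/-- The `j`-th coefficient error of the one-step estimate at level `n` with `m` free points:
`η_j = |q (−1)^j C(m,j) ε^{3j} − R (−ρ)^j/j!| (3v₁)^j`. [folklore] -/
def etaTerm (σ : ℝ) (N n m j : ℕ) : ℝ :=
  |qN uniformProfile σ N (n - 1) * ((-1 : ℝ) ^ j * (m.choose j : ℝ) * hsDiameter σ N ^ (3 * j)) -
      ratioLimit uniformProfile σ * ((-(σ ^ 3)) ^ j / (Nat.factorial j : ℝ))| * (3 * v₁) ^ j

/-- `0 ≤ η_j`. [folklore] -/
theorem etaTerm_nonneg (σ : ℝ) (N n m j : ℕ) : 0 ≤ etaTerm σ N n m j :=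
  mul_nonneg (abs_nonneg _) (pow_nonneg (mul_nonneg (by norm_num) v₁_pos.le) _)

/-- A summable majorant of `η_j`. [folklore] -/
theorem etaTerm_le (σ : ℝ) (N n m j : ℕ) : etaTerm σ N n m j ≤
    |qN uniformProfile σ N (n - 1)| * ((m.choose j : ℝ) * |hsDiameter σ N| ^ (3 * j)) * (3 * v₁) ^ j +
      |ratioLimit uniformProfile σ| * ((|σ ^ 3| * (3 * v₁)) ^ j / (Nat.factorial j : ℝ)) := by
  unfold etaTerm
  have e1 : |qN uniformProfile σ N (n - 1) * ((-1 : ℝ) ^ j * (m.choose j : ℝ) * hsDiameter σ N ^ (3 * j))|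
      = |qN uniformProfile σ N (n - 1)| * ((m.choose j : ℝ) * |hsDiameter σ N| ^ (3 * j)) := by
    rw [abs_mul, abs_mul, abs_mul, abs_pow, abs_pow, abs_neg, abs_one, one_pow, one_mul, Nat.abs_cast]
  have e2 : |ratioLimit uniformProfile σ * ((-(σ ^ 3)) ^ j / (Nat.factorial j : ℝ))|
      = |ratioLimit uniformProfile σ| * (|σ ^ 3| ^ j / (Nat.factorial j : ℝ)) := by
    rw [abs_mul, abs_div, abs_pow, abs_neg, Nat.abs_cast]
  have h3 : (0 : ℝ) ≤ (3 * v₁) ^ j := pow_nonneg (mul_nonneg (by norm_num) v₁_pos.le) _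
  calc _ ≤ (|qN uniformProfile σ N (n - 1) * ((-1 : ℝ) ^ j * (m.choose j : ℝ) * hsDiameter σ N ^ (3 * j))|
        + |ratioLimit uniformProfile σ * ((-(σ ^ 3)) ^ j / (Nat.factorial j : ℝ))|) * (3 * v₁) ^ j :=
        mul_le_mul_of_nonneg_right (abs_sub _ _) h3
    _ = _ := by rw [e1, e2, mul_pow]; ring

/-- `(η_j)_j` is summable. [folklore] -/
theorem summable_etaTerm (σ : ℝ) (N n m : ℕ) : Summable (etaTerm σ N n m) := by
  refine Summable.of_nonneg_of_le (etaTerm_nonneg σ N n m) (etaTerm_le σ N n m) (Summable.add ?_ ?_)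
  · refine summable_of_ne_finset_zero (s := Finset.range (m + 1)) fun j hj => ?_
    rw [Finset.mem_range, not_lt] at hj
    rw [Nat.choose_eq_zero_of_lt (by omega)]
    simp
  · exact (Real.summable_pow_div_factorial _).mul_left _

/-- The coefficient error of the one-step estimate: `η = ∑_j η_j`. [folklore] -/
def etaErr (σ : ℝ) (N n m : ℕ) : ℝ := ∑' j, etaTerm σ N n m j

/-- `0 ≤ η`. [folklore] -/
theorem etaErr_nonneg (σ : ℝ) (N n m : ℕ) : 0 ≤ etaErr σ N n m :=
  tsum_nonneg (etaTerm_nonneg σ N n m)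

/-- Measurability of `z ↦ v_n(Y(z))`. [folklore] -/
theorem measurable_vcan_comp {Ω : Type*} [MeasurableSpace Ω] (ε : ℝ) (n : ℕ) {k : ℕ}
    {Y : Ω → Fin k → T3} (hY : Measurable Y) : Measurable fun ω => vcan ε n (Y ω) :=
  (measurable_pinnedXi_comp ε hY _).div_const _

/-- The Kirkwood–Salsburg term at a configuration whose first point is the origin. [folklore] -/
theorem ksTerm_cons_zero (ρ : ℝ) (φ : HardSphereKS.CorrSeq E3) (k' j : ℕ) (x' : Fin k' → E3) :
    HardSphereKS.ksTerm ρ φ k' j (Fin.cons (0 : E3) x' : Fin (k' + 1) → E3) =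
      (-ρ) ^ j / (Nat.factorial j : ℝ) *
        ∫ ζ : Fin j → E3, HardSphereKS.ballProd (0 : E3) ζ * φ (k' + j) (Fin.append x' ζ) := by
  simp only [HardSphereKS.ksTerm, HardSphereKS.ksIntegrand, Fin.cons_zero, Fin.tail_cons]

section Step

variable {σ : ℝ} (h : SmallDensity uniformProfile σ)
include h

/-- **A priori bound** `v_n(y) ≤ 2^k` for all `k` (`n ≤ N + 1`). [cite: Ruelle1969, §4.2.2 (2.15)] -/
theorem vcan_le_two_pow' {N n k : ℕ} (hn : n ≤ N + 1) (y : Fin k → T3) :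
    vcan (hsDiameter σ N) n y ≤ 2 ^ k := by
  rcases le_or_gt k n with hk | hk
  · exact vcan_le_two_pow h hn hk y
  · rw [vcan, div_le_iff₀ (XiT_pos h hn), show n - k = n - n by omega]
    calc pinnedXi (hsDiameter σ N) y (n - n) ≤ XiT (hsDiameter σ N) (n - n) :=
          pinnedXi_le_pinnedXi_elim0 _ y _
      _ ≤ 2 ^ n * XiT (hsDiameter σ N) n := XiT_sub_le_pow_mul h hn le_rfl
      _ ≤ 2 ^ k * XiT (hsDiameter σ N) n :=
          mul_le_mul_of_nonneg_right (pow_le_pow_right₀ (by norm_num) hk.le) (XiT_nonneg _ _)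

/-- `|v_n(y)| ≤ 2^k`. [folklore] -/
theorem abs_vcan_le {N n k : ℕ} (hn : n ≤ N + 1) (y : Fin k → T3) :
    |vcan (hsDiameter σ N) n y| ≤ 2 ^ k := by
  rw [abs_of_nonneg (vcan_nonneg _ _ _)]; exact vcan_le_two_pow' h hn y

/-- The fixed-point equation at order `k' + 1`. [cite: Ruelle1969, §4.2.3 Thm 4.2.3] -/
theorem gLim_succ (k' : ℕ) (x : Fin (k' + 1) → E3) :
    gLim σ (k' + 1) x = ratioLimit uniformProfile σ * HardSphereKS.wall x *
      ∑' j, HardSphereKS.ksTerm (σ ^ 3) (gLim σ) k' j x := by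
  have e := congrFun (congrFun (ksOp_gLim h) (k' + 1)) x
  rw [HardSphereKS.ksOp_succ] at e
  exact e.symm

/-- **The one-step estimate** (Ruelle's contraction, canonical version): the invariant at level
`n − 1`, window `2r`, bound `b` implies the invariant at level `n`, window `r`, bound
`max (θ₀ b + E) (2 (3/4)^K)`, where `E` dominates the coefficient errors `η(n, n − k)`, `k ≤ K`.
[cite: Ruelle1969, §4.2.2–4.2.3] -/
theorem ksInv_step {N n K : ℕ} {r b E : ℝ} (hn1 : 1 ≤ n) (hn : n ≤ N + 1)
    (hεr : hsDiameter σ N ≤ r) (hr : 2 * r ≤ 1 / 4) (hb : 0 ≤ b)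
    (hη : ∀ k, 1 ≤ k → k ≤ K → etaErr σ N n (n - k) ≤ E)
    (hI : KSInv σ N (n - 1) (2 * r) b) :
    KSInv σ N n r (max (thetaZero σ * b + E) (2 * (3 / 4) ^ K)) := by
  intro k Y c hYc
  have hε : 0 < hsDiameter σ N := hsDiameter_pos h.σ_pos N
  have hε2 : hsDiameter σ N < 1 / 2 := by linarith
  have hΞn : 0 < XiT (hsDiameter σ N) n := XiT_pos h hn
  have hΞ : 0 < XiT (hsDiameter σ N) (n - 1) := XiT_pos h (by omega)
  have hmax0 : 0 ≤ max (thetaZero σ * b + E) (2 * (3 / 4) ^ K) :=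
    le_max_of_le_right (by positivity)
  -- the trivial bound, valid for all `k`
  have htriv : |vcan (hsDiameter σ N) n Y - gLim σ k (liftAt (hsDiameter σ N) c Y)| ≤ 2 ^ k + 3 ^ k :=
    (abs_sub _ _).trans (add_le_add (abs_vcan_le h hn Y) (abs_gLim_le h k _))
  obtain _ | k' := k
  · -- `k = 0`: both sides are `1`
    rw [vcan_elim0 _ hΞn Y, gLim_zero h, sub_self, abs_zero]
    positivity
  rcases le_or_gt (k' + 1) K with hkK | hkK
  swap
  · -- `k > K`: the trivial bound
    refine htriv.trans ?_
    refine le_trans ?_ (mul_le_mul_of_nonneg_right (le_max_right _ _) (by positivity))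
    have h34 : (3 : ℝ) ^ (k' + 1) = (3 / 4) ^ (k' + 1) * 4 ^ (k' + 1) := by
      rw [← mul_pow]; norm_num
    have hKk : (3 / 4 : ℝ) ^ (k' + 1) ≤ (3 / 4) ^ K :=
      pow_le_pow_of_le_one (by norm_num) (by norm_num) hkK.le
    have h23 : (2 : ℝ) ^ (k' + 1) ≤ 3 ^ (k' + 1) := pow_le_pow_left₀ (by norm_num) (by norm_num) _
    nlinarith [pow_pos (by norm_num : (0 : ℝ) < 4) (k' + 1)]
  -- the main case `1 ≤ k = k' + 1 ≤ K`
  refine le_trans ?_ (mul_le_mul_of_nonneg_right (le_max_left _ _) (by positivity))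
  obtain ⟨y₁, y', rfl⟩ : ∃ y₁ y', Y = Fin.cons y₁ y' := ⟨Y 0, Fin.tail Y, (Fin.cons_self_tail Y).symm⟩
  have hy1c : Torus.euclidDist y₁ c < r := by simpa using hYc 0
  have hy'c : ∀ i, Torus.euclidDist (y' i) c < r := fun i => by simpa using hYc i.succ
  have hr0 : 0 < r := lt_of_lt_of_le hε hεr
  have hv₁ : 0 < v₁ := v₁_pos
  -- notation
  set ε := hsDiameter σ N with hεdef
  set ρ := σ ^ 3 with hρ
  set R := ratioLimit uniformProfile σ with hR
  set q := qN uniformProfile σ N (n - 1) with hq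
  set m := n - (k' + 1) with hm
  set x' : Fin k' → E3 := liftAt ε y₁ y' with hx'
  set w := wallInd ε y₁ y' with hw
  have hq0 : 0 ≤ q := (qN_pos h.σ_pos.le h.σ_lt_half h.ovDensity_lt_one (by omega)).le
  have hq2 : q ≤ 2 := h.qN_le_two (by omega)
  have hR0 : 0 ≤ R := h.ratioLimit_pos.le
  have hw01 : 0 ≤ w ∧ w ≤ 1 := ⟨(wallInd_mem_Icc ε y₁ y').1, (wallInd_mem_Icc ε y₁ y').2⟩
  -- the two families of ball integrals
  set A : ℕ → ℝ := fun j => ∫ ζ : Fin j → E3, HardSphereKS.ballProd (0 : E3) ζ *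
    vcan ε (n - 1) (Fin.append y' (chartPts ε y₁ ζ)) with hA
  set B : ℕ → ℝ := fun j => ∫ ζ : Fin j → E3, HardSphereKS.ballProd (0 : E3) ζ *
    gLim σ (k' + j) (Fin.append x' ζ) with hB
  set α : ℕ → ℝ := fun j => q * ((-1 : ℝ) ^ j * (m.choose j : ℝ) * ε ^ (3 * j)) with hα
  set β : ℕ → ℝ := fun j => R * ((-ρ) ^ j / (Nat.factorial j : ℝ)) with hβ
  -- Step 1: the `v` side via the canonical KS identity and the chart
  have hv : vcan ε n (Fin.cons y₁ y') = w * ∑ j ∈ Finset.range (m + 1), α j * A j := by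
    rw [vcan_cons ε hΞ hΞn y₁ y', ← qN_eq_XiT_div hn1 hn]
    have hch : ∀ j, ∫ z : Fin j → T3, ballInd ε y₁ z * vcan ε (n - 1) (Fin.append y' z) =
        ε ^ (3 * j) * A j := fun j =>
      integral_ballInd_mul_eq_pow_mul hε hε2 y₁
        (measurable_vcan_comp ε (n - 1) (measurable_append_right_T3 y'))
    simp only [hch, Finset.mul_sum]
    refine Finset.sum_congr rfl fun j _ => ?_
    simp only [hα, hw]; ring
  -- Step 2: the `g` side via the fixed-point equation
  have hbase : gLim σ (k' + 1) (liftAt ε c (Fin.cons y₁ y')) =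
      gLim σ (k' + 1) (Fin.cons (0 : E3) x' : Fin (k' + 1) → E3) := by
    have hY4 : ∀ a, Torus.euclidDist ((Fin.cons y₁ y' : Fin (k' + 1) → T3) a) c < 1 / 4 :=
      fun a => (hYc a).trans_le (by linarith)
    have e : liftAt ε y₁ (Fin.cons y₁ y') =
        fun a => -(ε⁻¹ • Torus.reprSym (y₁ - c)) + liftAt ε c (Fin.cons y₁ y') a :=
      funext fun a => liftAt_eq_add_liftAt hY4 (by simpa using hY4 0) a
    rw [← liftAt_cons ε y₁ y', e, gLim_const_add h]
  have hsumB : Summable fun j => (-ρ) ^ j / (Nat.factorial j : ℝ) * B j := by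
    have := summable_ksTerm_gLim h k' (Fin.cons (0 : E3) x' : Fin (k' + 1) → E3)
    simp only [ksTerm_cons_zero] at this
    exact this
  set T := ∑' j, (-ρ) ^ j / (Nat.factorial j : ℝ) * B j with hT
  have hg : gLim σ (k' + 1) (Fin.cons (0 : E3) x' : Fin (k' + 1) → E3) = R * w * T := by
    rw [gLim_succ h k' (Fin.cons (0 : E3) x' : Fin (k' + 1) → E3)]
    simp only [ksTerm_cons_zero]
    congr 1
    rw [hw, wallInd_eq_wall hε y₁ y', liftAt_cons]
  -- Step 3: the difference as one series
  have hS : HasSum (fun j => α j * A j) (∑ j ∈ Finset.range (m + 1), α j * A j) := by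
    refine hasSum_sum_of_ne_finset_zero fun j hj => ?_
    rw [Finset.mem_range, not_lt] at hj
    simp only [hα]
    rw [Nat.choose_eq_zero_of_lt (by omega)]
    simp
  have hT' : HasSum (fun j => β j * B j) (R * T) := by
    have e : (fun j => β j * B j) = fun j => R * ((-ρ) ^ j / (Nat.factorial j : ℝ) * B j) := by
      funext j; simp only [hβ]; ring
    rw [e]
    exact hsumB.hasSum.mul_left R
  have hd : HasSum (fun j => α j * A j - β j * B j)
      ((∑ j ∈ Finset.range (m + 1), α j * A j) - R * T) := hS.sub hT'
  -- Step 4: termwise bounds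
  have hBb : ∀ j, |B j| ≤ v₁ ^ j * 3 ^ (k' + j) := fun j => by
    rw [← v1_E3_eq]
    exact HardSphereKS.abs_integral_ballProd_mul_le (0 : E3) fun ζ => abs_gLim_le h _ _
  have hAB : ∀ j, |A j - B j| ≤ v₁ ^ j * (b * 4 ^ (k' + j)) := by
    intro j
    have hintA : Integrable fun ζ : Fin j → E3 => HardSphereKS.ballProd (0 : E3) ζ *
        vcan ε (n - 1) (Fin.append y' (chartPts ε y₁ ζ)) :=
      integrable_ballProd_mul (measurable_vcan_comp ε (n - 1)
        ((measurable_append_right_T3 y').comp (measurable_chartPts ε y₁ j)))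
        (M := 2 ^ (k' + j)) fun ζ => abs_vcan_le h (by omega) _
    have hintB : Integrable fun ζ : Fin j → E3 => HardSphereKS.ballProd (0 : E3) ζ *
        gLim σ (k' + j) (Fin.append x' ζ) :=
      integrable_ballProd_mul ((measurable_gLim h _).comp
        (HardSphereKS.continuous_append_right x').measurable) fun ζ => abs_gLim_le h _ _
    have hsub : A j - B j = ∫ ζ : Fin j → E3, HardSphereKS.ballProd (0 : E3) ζ *
        (vcan ε (n - 1) (Fin.append y' (chartPts ε y₁ ζ)) - gLim σ (k' + j) (Fin.append x' ζ)) := by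
      simp only [hA, hB]
      rw [← integral_sub hintA hintB]
      refine integral_congr_ae (ae_of_all _ fun ζ => ?_)
      ring
    rw [hsub]
    refine abs_integral_ballProd_mul_le_of_ball (by positivity) fun ζ hζ => ?_
    -- the induction hypothesis at the appended configuration, centre `y₁`, window `2r`
    have hwin : ∀ a, Torus.euclidDist (Fin.append y' (chartPts ε y₁ ζ) a) y₁ < 2 * r := by
      intro a
      refine Fin.addCases (fun i => ?_) (fun i => ?_) a
      · rw [Fin.append_left]
        calc Torus.euclidDist (y' i) y₁ ≤ Torus.euclidDist (y' i) c + Torus.euclidDist c y₁ :=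
              euclidDist_triangle _ _ _
          _ < r + r := add_lt_add (hy'c i) (by rw [Torus.euclidDist_comm]; exact hy1c)
          _ = 2 * r := by ring
      · rw [Fin.append_right]
        exact (euclidDist_chartPts_lt hε hε2 y₁ hζ i).trans_le (by linarith)
    have := hI (k' + j) (Fin.append y' (chartPts ε y₁ ζ)) y₁ hwin
    rwa [liftAt_append, liftAt_chartPts hε hε2 y₁ hζ] at this
  have habsα : ∀ j, |α j| = q * ((m.choose j : ℝ) * ε ^ (3 * j)) := fun j => by
    simp only [hα]
    rw [abs_mul, abs_mul, abs_mul, abs_pow, abs_pow, abs_neg, abs_one, one_pow, one_mul,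
      Nat.abs_cast, abs_of_nonneg hq0, abs_of_pos hε]
  have hterm : ∀ j, ‖α j * A j - β j * B j‖ ≤
      q * ((m.choose j : ℝ) * ε ^ (3 * j)) * (v₁ ^ j * (b * 4 ^ (k' + j))) +
        (3 : ℝ) ^ k' * etaTerm σ N n m j := by
    intro j
    rw [Real.norm_eq_abs]
    have e : α j * A j - β j * B j = α j * (A j - B j) + (α j - β j) * B j := by ring
    have hη' : |α j - β j| * |B j| ≤ (3 : ℝ) ^ k' * etaTerm σ N n m j := by
      have : (3 : ℝ) ^ k' * etaTerm σ N n m j = |α j - β j| * (v₁ ^ j * 3 ^ (k' + j)) := by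
        simp only [etaTerm, hα, hβ, hq, hR, hρ, hεdef, hm]; ring
      rw [this]
      exact mul_le_mul_of_nonneg_left (hBb j) (abs_nonneg _)
    rw [e]
    calc _ ≤ |α j * (A j - B j)| + |(α j - β j) * B j| := abs_add_le _ _
      _ = |α j| * |A j - B j| + |α j - β j| * |B j| := by
          rw [abs_mul (α j) (A j - B j), abs_mul (α j - β j) (B j)]
      _ ≤ _ := add_le_add (by rw [habsα]; exact mul_le_mul_of_nonneg_left (hAB j) (by positivity)) hη'
  -- Step 5: the majorant series
  have hM1 : HasSum (fun j => q * ((m.choose j : ℝ) * ε ^ (3 * j)) * (v₁ ^ j * (b * 4 ^ (k' + j))))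
      (q * (b * 4 ^ k') * (4 * v₁ * ε ^ 3 + 1) ^ m) := by
    have hfin : ∀ j ∉ Finset.range (m + 1),
        q * ((m.choose j : ℝ) * ε ^ (3 * j)) * (v₁ ^ j * (b * 4 ^ (k' + j))) = 0 := by
      intro j hj
      rw [Finset.mem_range, not_lt] at hj
      rw [Nat.choose_eq_zero_of_lt (by omega)]
      simp
    have hs : HasSum (fun j => q * ((m.choose j : ℝ) * ε ^ (3 * j)) * (v₁ ^ j * (b * 4 ^ (k' + j))))
        (∑ j ∈ Finset.range (m + 1),
          q * ((m.choose j : ℝ) * ε ^ (3 * j)) * (v₁ ^ j * (b * 4 ^ (k' + j)))) :=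
      hasSum_sum_of_ne_finset_zero hfin
    have e : ∑ j ∈ Finset.range (m + 1),
        q * ((m.choose j : ℝ) * ε ^ (3 * j)) * (v₁ ^ j * (b * 4 ^ (k' + j))) =
          q * (b * 4 ^ k') * (4 * v₁ * ε ^ 3 + 1) ^ m := by
      rw [add_pow, Finset.mul_sum]
      refine Finset.sum_congr rfl fun j _ => ?_
      ring
    rwa [e] at hs
  have hM2 : HasSum (fun j => (3 : ℝ) ^ k' * etaTerm σ N n m j) ((3 : ℝ) ^ k' * etaErr σ N n m) :=
    (summable_etaTerm σ N n m).hasSum.mul_left _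
  have hmaj := hd.norm_le_of_bounded (hM1.add hM2) hterm
  rw [Real.norm_eq_abs] at hmaj
  -- Step 6: the two constants
  have hpow : (4 * v₁ * ε ^ 3 + 1) ^ m ≤ Real.exp (4 * (v₁ * σ ^ 3)) := by
    have h1 : (4 * v₁ * ε ^ 3 + 1) ^ m ≤ Real.exp (4 * v₁ * ε ^ 3) ^ m :=
      pow_le_pow_left₀ (by positivity) (Real.add_one_le_exp _) m
    refine h1.trans ?_
    rw [← Real.exp_nat_mul, Real.exp_le_exp]
    have hm1 : (m : ℝ) ≤ (N + 1 : ℕ) := by exact_mod_cast (show m ≤ N + 1 by omega)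
    have e := succ_mul_hsDiameter_pow_three σ N
    rw [← hεdef] at e
    have := mul_le_mul_of_nonneg_right hm1 (by positivity : (0 : ℝ) ≤ 4 * v₁ * ε ^ 3)
    nlinarith
  have hT1 : q * (b * 4 ^ k') * (4 * v₁ * ε ^ 3 + 1) ^ m ≤ thetaZero σ * b * 4 ^ (k' + 1) := by
    calc _ ≤ 2 * (b * 4 ^ k') * Real.exp (4 * (v₁ * σ ^ 3)) :=
          mul_le_mul (mul_le_mul_of_nonneg_right hq2 (by positivity)) hpow (by positivity)
            (by positivity)
      _ = thetaZero σ * b * 4 ^ (k' + 1) := by rw [thetaZero, pow_succ]; ring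
  have hT2 : (3 : ℝ) ^ k' * etaErr σ N n m ≤ E * 4 ^ (k' + 1) := by
    have h34 : (3 : ℝ) ^ k' ≤ 4 ^ (k' + 1) :=
      (pow_le_pow_left₀ (by norm_num) (by norm_num) _).trans
        (pow_le_pow_right₀ (by norm_num) (Nat.le_succ _))
    calc _ ≤ (4 : ℝ) ^ (k' + 1) * E :=
          mul_le_mul h34 (hη (k' + 1) le_add_self hkK) (etaErr_nonneg _ _ _ _) (by positivity)
      _ = E * 4 ^ (k' + 1) := mul_comm _ _
  -- Step 7: assemble
  rw [hbase, hv, hg, show w * (∑ j ∈ Finset.range (m + 1), α j * A j) - R * w * T =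
    w * ((∑ j ∈ Finset.range (m + 1), α j * A j) - R * T) by ring, abs_mul, abs_of_nonneg hw01.1]
  calc _ ≤ 1 * |(∑ j ∈ Finset.range (m + 1), α j * A j) - R * T| :=
        mul_le_mul_of_nonneg_right hw01.2 (abs_nonneg _)
    _ ≤ _ := by rw [one_mul]; exact hmaj.trans (by linarith)

end Step

/-! ### Iterating the one-step estimate -/

/-- The invariant is monotone in the bound and antitone in the window. [folklore] -/
theorem KSInv.mono {σ : ℝ} {N n : ℕ} {r r' b b' : ℝ} (hI : KSInv σ N n r b) (hr : r' ≤ r)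
    (hb : b ≤ b') : KSInv σ N n r' b' := fun k Y c hY =>
  (hI k Y c fun a => (hY a).trans_le hr).trans (mul_le_mul_of_nonneg_right hb (by positivity))

/-- The bounds along the iteration: `b₀ = 2`, `b_{i+1} = max (θ b_i + E) τ`. [folklore] -/
def bseq (θ E τ : ℝ) : ℕ → ℝ
  | 0 => 2
  | i + 1 => max (θ * bseq θ E τ i + E) τ

/-- `0 ≤ b_i`. [folklore] -/
theorem bseq_nonneg {θ E τ : ℝ} (hτ : 0 ≤ τ) : ∀ i, 0 ≤ bseq θ E τ i
  | 0 => by simp [bseq]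
  | _ + 1 => le_max_of_le_right hτ

/-- `b_i ≤ 2 θ^i + (E + τ)/(1 − θ)`. [folklore] -/
theorem bseq_le {θ E τ : ℝ} (hθ0 : 0 ≤ θ) (hθ1 : θ < 1) (hE : 0 ≤ E) (hτ : 0 ≤ τ) :
    ∀ i, bseq θ E τ i ≤ 2 * θ ^ i + (E + τ) / (1 - θ)
  | 0 => by
    simp only [bseq, pow_zero, mul_one, le_add_iff_nonneg_right]
    exact div_nonneg (by positivity) (by linarith)
  | i + 1 => by
    have ih := bseq_le hθ0 hθ1 hE hτ i
    have hden : 0 < 1 - θ := by linarith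
    have key : (E + τ) / (1 - θ) - θ * ((E + τ) / (1 - θ)) = E + τ := by
      field_simp
    have hS : E + τ ≤ (E + τ) / (1 - θ) := by
      rw [le_div_iff₀ hden]; nlinarith
    simp only [bseq]
    refine max_le ?_ ?_
    · calc θ * bseq θ E τ i + E ≤ θ * (2 * θ ^ i + (E + τ) / (1 - θ)) + E := by gcongr
        _ ≤ _ := by rw [pow_succ]; nlinarith
    · have : 0 ≤ 2 * θ ^ (i + 1) := by positivity
      linarith

section Iterate

variable {σ : ℝ} (h : SmallDensity uniformProfile σ)
include h

/-- **The trivial invariant** `|v − g| ≤ 2^k + 3^k ≤ 2 · 4^k`. [folklore] -/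
theorem ksInv_two {N n : ℕ} (hn : n ≤ N + 1) (r : ℝ) : KSInv σ N n r 2 := by
  intro k Y c _
  have h2 : (2 : ℝ) ^ k ≤ 4 ^ k := pow_le_pow_left₀ (by norm_num) (by norm_num) k
  have h3 : (3 : ℝ) ^ k ≤ 4 ^ k := pow_le_pow_left₀ (by norm_num) (by norm_num) k
  calc _ ≤ |vcan (hsDiameter σ N) n Y| + |gLim σ k (liftAt (hsDiameter σ N) c Y)| := abs_sub _ _
    _ ≤ 2 ^ k + 3 ^ k := add_le_add (abs_vcan_le h hn Y) (abs_gLim_le h k _)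
    _ ≤ 2 * 4 ^ k := by linarith

/-- **The iterated estimate**: `s` steps up from the trivial invariant at level `N + 1 − s`.
[cite: Ruelle1969, §4.2.3] -/
theorem ksInv_iterate {N s K : ℕ} {r E : ℝ} (hs : s ≤ N + 1) (hεr : hsDiameter σ N ≤ r)
    (hr : 2 ^ s * r ≤ 1 / 4)
    (hη : ∀ i, 1 ≤ i → i ≤ s → ∀ k, 1 ≤ k → k ≤ K →
      etaErr σ N (N + 1 - s + i) (N + 1 - s + i - k) ≤ E) :
    ∀ i, i ≤ s → KSInv σ N (N + 1 - s + i) (2 ^ (s - i) * r)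
      (bseq (thetaZero σ) E (2 * (3 / 4) ^ K) i) := by
  have hε : 0 < hsDiameter σ N := hsDiameter_pos h.σ_pos N
  have hr0 : 0 ≤ r := hε.le.trans hεr
  intro i
  induction i with
  | zero => exact fun _ => ksInv_two h (by omega) _
  | succ i ih =>
    intro hi
    have hI := ih (by omega)
    have hpow : (2 : ℝ) ^ (s - i) = 2 * 2 ^ (s - (i + 1)) := by
      rw [← pow_succ', show s - (i + 1) + 1 = s - i by omega]
    rw [hpow, mul_assoc] at hI
    have hstep := ksInv_step h (n := N + 1 - s + (i + 1)) (K := K) (E := E)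
      (r := 2 ^ (s - (i + 1)) * r) (b := bseq (thetaZero σ) E (2 * (3 / 4) ^ K) i)
      (by omega) (by omega) ?_ ?_ (bseq_nonneg (by positivity) i)
      (fun k hk1 hkK => hη (i + 1) le_add_self hi k hk1 hkK)
      (by rwa [show N + 1 - s + (i + 1) - 1 = N + 1 - s + i by omega])
    · exact hstep
    · calc hsDiameter σ N ≤ 1 * r := by rwa [one_mul]
        _ ≤ 2 ^ (s - (i + 1)) * r := mul_le_mul_of_nonneg_right (one_le_pow₀ (by norm_num)) hr0
    · calc 2 * (2 ^ (s - (i + 1)) * r) = 2 ^ (s - i) * r := by rw [hpow, mul_assoc]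
        _ ≤ 2 ^ s * r := mul_le_mul_of_nonneg_right (pow_le_pow_right₀ (by norm_num) (by omega)) hr0
        _ ≤ 1 / 4 := hr

/-! ### The coefficient errors tend to zero -/

/-- The uniform summable majorant of the coefficient errors:
`η_j(N) ≤ 4 (3 v₁ σ³)^j / j!`. [folklore] -/
theorem etaTerm_le_uniform (N l t j : ℕ) :
    etaTerm σ N (N + 1 - l) (N - t) j ≤ 4 * ((σ ^ 3 * (3 * v₁)) ^ j / (Nat.factorial j : ℝ)) := by
  have hv₁ : 0 < v₁ := v₁_pos
  have hε : 0 < hsDiameter σ N := hsDiameter_pos h.σ_pos N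
  have hρ : 0 < σ ^ 3 := pow_pos h.σ_pos 3
  have hq0 : 0 ≤ qN uniformProfile σ N (N + 1 - l - 1) :=
    (qN_pos h.σ_pos.le h.σ_lt_half h.ovDensity_lt_one (by omega)).le
  have hq2 : qN uniformProfile σ N (N + 1 - l - 1) ≤ 2 := h.qN_le_two (by omega)
  have hR0 : 0 ≤ ratioLimit uniformProfile σ := h.ratioLimit_pos.le
  have hR2 : ratioLimit uniformProfile σ ≤ 2 := h.ratioLimit_mem.2
  refine (etaTerm_le σ N _ _ j).trans ?_
  rw [abs_of_nonneg hq0, abs_of_nonneg hR0, abs_of_pos hε, abs_of_pos hρ]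
  -- `C(N − t, j) ε^{3j} ≤ ρ^j / j!`
  have hC : ((N - t).choose j : ℝ) * hsDiameter σ N ^ (3 * j) ≤ (σ ^ 3) ^ j / (Nat.factorial j : ℝ) := by
    have h1 : ((N - t).choose j : ℝ) ≤ ((N - t : ℕ) : ℝ) ^ j / (Nat.factorial j : ℝ) :=
      Nat.choose_le_pow_div j (N - t)
    have h2 : ((N - t : ℕ) : ℝ) ≤ ((N + 1 : ℕ) : ℝ) := by exact_mod_cast (show N - t ≤ N + 1 by omega)
    have h3 : ((N - t : ℕ) : ℝ) ^ j * hsDiameter σ N ^ (3 * j) ≤ (σ ^ 3) ^ j := by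
      rw [pow_mul, ← mul_pow, ← succ_mul_hsDiameter_pow_three σ N]
      exact pow_le_pow_left₀ (by positivity) (mul_le_mul_of_nonneg_right h2 (by positivity)) j
    calc ((N - t).choose j : ℝ) * hsDiameter σ N ^ (3 * j)
        ≤ ((N - t : ℕ) : ℝ) ^ j / (Nat.factorial j : ℝ) * hsDiameter σ N ^ (3 * j) :=
          mul_le_mul_of_nonneg_right h1 (by positivity)
      _ = ((N - t : ℕ) : ℝ) ^ j * hsDiameter σ N ^ (3 * j) / (Nat.factorial j : ℝ) := by ring
      _ ≤ _ := div_le_div_of_nonneg_right h3 (by positivity)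
  have h3v : (0 : ℝ) ≤ (3 * v₁) ^ j := by positivity
  calc qN uniformProfile σ N (N + 1 - l - 1) * (((N - t).choose j : ℝ) * hsDiameter σ N ^ (3 * j)) *
        (3 * v₁) ^ j + ratioLimit uniformProfile σ * ((σ ^ 3 * (3 * v₁)) ^ j / (Nat.factorial j : ℝ))
      ≤ 2 * ((σ ^ 3) ^ j / (Nat.factorial j : ℝ)) * (3 * v₁) ^ j +
          2 * ((σ ^ 3 * (3 * v₁)) ^ j / (Nat.factorial j : ℝ)) := by
        exact add_le_add (mul_le_mul_of_nonneg_right (mul_le_mul hq2 hC (by positivity) (by norm_num)) h3v)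
          (mul_le_mul_of_nonneg_right hR2 (by positivity))
    _ = 4 * ((σ ^ 3 * (3 * v₁)) ^ j / (Nat.factorial j : ℝ)) := by rw [mul_pow]; ring

/-- **The coefficient errors tend to zero**: for fixed shifts `l, t`,
`η(N, N + 1 − l, N − t) → 0` (Tannery's theorem: termwise `q_N(N − l) → R` and
`C(N − t, j) ε_N^{3j} → ρ^j/j!`, dominated by `4 (3λ)^j/j!`). [folklore] -/
theorem tendsto_etaErr (l t : ℕ) :
    Tendsto (fun N => etaErr σ N (N + 1 - l) (N - t)) atTop (𝓝 0) := by
  have hv₁ : 0 < v₁ := v₁_pos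
  set ρ := σ ^ 3 with hρ
  set R := ratioLimit uniformProfile σ with hR
  have hterm : ∀ j, Tendsto (fun N => etaTerm σ N (N + 1 - l) (N - t) j) atTop (𝓝 0) := by
    intro j
    have h1 : Tendsto (fun N => qN uniformProfile σ N (N - l) *
        ((-1 : ℝ) ^ j * (((N - t).choose j : ℝ) * hsDiameter σ N ^ (3 * j)))) atTop
        (𝓝 (R * ((-1 : ℝ) ^ j * (ρ ^ j / (Nat.factorial j : ℝ))))) :=
      (h.tendsto_qN_sub l).mul (tendsto_const_nhds.mul (tendsto_choose_sub_mul_hsDiameter_pow σ t j))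
    have h2 := ((h1.sub (tendsto_const_nhds (x := R * ((-ρ) ^ j / (Nat.factorial j : ℝ))))).abs).mul_const
      ((3 * v₁) ^ j)
    have hlim : |R * ((-1 : ℝ) ^ j * (ρ ^ j / (Nat.factorial j : ℝ))) - R * ((-ρ) ^ j / (Nat.factorial j : ℝ))|
        * (3 * v₁) ^ j = 0 := by
      rw [neg_pow ρ j, mul_div_assoc, sub_self, abs_zero, zero_mul]
    rw [hlim] at h2
    refine h2.congr fun N => ?_
    simp only [etaTerm, show N + 1 - l - 1 = N - l by omega, mul_assoc, hρ, hR]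
  have hmaj := etaTerm_le_uniform h (l := l) (t := t)
  have := tendsto_tsum_of_dominated_convergence (𝓕 := atTop)
    (f := fun N j => etaTerm σ N (N + 1 - l) (N - t) j) (g := fun _ => (0 : ℝ))
    (bound := fun j => 4 * ((σ ^ 3 * (3 * v₁)) ^ j / (Nat.factorial j : ℝ)))
    ((Real.summable_pow_div_factorial _).mul_left 4) hterm
    (Eventually.of_forall fun N j => by
      rw [Real.norm_eq_abs, abs_of_nonneg (etaTerm_nonneg _ _ _ _ _)]
      exact hmaj N j)
  simpa only [tsum_zero, etaErr] using this

/-! ### The thermodynamic limit of the correlation functions at contact scale -/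

/-- **The thermodynamic limit of the canonical correlation functions at contact scale**
(Bogoliubov–Khatset–Petrina–Ruelle, canonical ensemble on `𝕋³`): for every `δ > 0` and every
window `L`, for all large `N`, every configuration `Y` of `k` points within minimal-image distance
`L ε_N` of a centre `c` satisfies

  `|v_{N+1}(Y) − g_k(ε_N⁻¹ · lift_c Y)| ≤ δ 4^k`,

where `v_{N+1}(Y) = u_{ε_N}(Y)(N + 1 − k)/Ξ_{ε_N}(N + 1)` is the normalised pinned probability of
the `N + 1`-particle gas and `g = gLim σ` the infinite-volume correlation functions (density
normalisation) at reduced density `σ³`. [cite: Ruelle1969, §4.2.3 Thm 4.2.3;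
PulvirentiTsagkarogiannis2012, Thm 2.1] -/
theorem ksInv_eventually (L : ℝ) {δ : ℝ} (hδ : 0 < δ) :
    ∀ᶠ N in atTop, KSInv σ N (N + 1) (L * hsDiameter σ N) δ := by
  have hθ0 : 0 ≤ thetaZero σ := thetaZero_nonneg
  have hθ1 : thetaZero σ < 1 := thetaZero_lt_one h
  have hden : 0 < 1 - thetaZero σ := by linarith
  -- the number of steps `s`, the truncation `K` and the error level `E`
  obtain ⟨s, hs⟩ : ∃ s : ℕ, thetaZero σ ^ s < δ / 6 := exists_pow_lt_of_lt_one (by positivity) hθ1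
  obtain ⟨K, hK⟩ : ∃ K : ℕ, (3 / 4 : ℝ) ^ K < (1 - thetaZero σ) * δ / 6 :=
    exists_pow_lt_of_lt_one (by positivity) (by norm_num)
  set E := (1 - thetaZero σ) * δ / 3 with hE
  have hE0 : 0 < E := by positivity
  set τ := 2 * (3 / 4 : ℝ) ^ K with hτ
  have hτ0 : 0 ≤ τ := by positivity
  have hb : bseq (thetaZero σ) E τ s ≤ δ := by
    refine (bseq_le hθ0 hθ1 hE0.le hτ0 s).trans ?_
    have h1 : (E + τ) / (1 - thetaZero σ) ≤ 2 * δ / 3 := by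
      rw [div_le_iff₀ hden]
      have : τ ≤ (1 - thetaZero σ) * δ / 3 := by rw [hτ]; linarith
      linarith
    linarith
  -- the window
  set L' := max L 1 with hL'
  have hL'1 : 1 ≤ L' := le_max_right _ _
  -- eventually: enough particles, small window, small coefficient errors
  have ev1 : ∀ᶠ N : ℕ in atTop, s ≤ N + 1 := by
    filter_upwards [eventually_ge_atTop s] with N hN; omega
  have ev2 : ∀ᶠ N : ℕ in atTop, 2 ^ s * (L' * hsDiameter σ N) ≤ 1 / 4 := by
    have := ((tendsto_hsDiameter σ).const_mul (2 ^ s * L'))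
    rw [mul_zero] at this
    filter_upwards [this.eventually (eventually_le_nhds (by norm_num : (0 : ℝ) < 1 / 4))] with N hN
    linarith [hN]
  have ev3 : ∀ᶠ N : ℕ in atTop, ∀ i ∈ Finset.range (s + 1), ∀ k ∈ Finset.range (K + 1),
      1 ≤ i → 1 ≤ k → etaErr σ N (N + 1 - s + i) (N + 1 - s + i - k) ≤ E := by
    refine (eventually_all_finset _).2 fun i hi => (eventually_all_finset _).2 fun k hk => ?_
    rw [Finset.mem_range] at hi hk
    have ht := (tendsto_etaErr h (s - i) (s - i + k - 1)).eventually (eventually_lt_nhds hE0)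
    filter_upwards [ht, ev1] with N hN hN1 hi1 hk1
    rw [show N + 1 - s + i = N + 1 - (s - i) by omega,
      show N + 1 - (s - i) - k = N - (s - i + k - 1) by omega]
    exact hN.le
  filter_upwards [ev1, ev2, ev3] with N hN1 hN2 hN3
  have hε : 0 < hsDiameter σ N := hsDiameter_pos h.σ_pos N
  have hit := ksInv_iterate h (K := K) (E := E) hN1 (r := L' * hsDiameter σ N)
    (by nlinarith) hN2 (fun i hi1 his k hk1 hkK => hN3 i (Finset.mem_range.2 (by omega)) k
      (Finset.mem_range.2 (by omega)) hi1 hk1) s le_rfl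
  rw [show N + 1 - s + s = N + 1 by omega, Nat.sub_self, pow_zero, one_mul] at hit
  exact hit.mono (mul_le_mul_of_nonneg_right (le_max_left _ _) hε.le) hb

end Iterate


end Literature.MathematicalPhysics.KineticTheory
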